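import Mathlib
import HarnessLib
import Summits.HubbardSuperconductivity.HubbardSuperconductivity.Theorems.KLProgrammeKLRegimeEngineFrameShiftDressingSup
import Summits.HubbardSuperconductivity.HubbardSuperconductivity.Theorems.KLProgrammeKLRegimeEngineDressedAliasingLast

/-!
# K3 gen-8-FLOW (stmt 20437, stub (C), «(C)-B-LAST»): the model layer of the (B) door's sup route at the LAST flow step — tree and dressing jets WITHOUT the
# vanishing hypothesis (Leibniz term at the reading point + aliasing)

Cell gate-hubbard-kl, seat p2 g15.  Twins of `…EngineFrameShiftDressingSup` (p579409): at `m = n_β` the reading point is not below the shell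
(`Λ_m ∈ [π/β, 4π/β]`), the continuum factors `g_i` (tree) and `a_i, b_i` (dressing) do NOT vanish near `q`, and layer 3′
(`…EngineDressedAliasingLast.norm_iteratedFDeriv_evalM_symInterp_dressed_le_of_jets`, p593524) replaces layer 3: every dressed term gains the Leibniz summand
`2·(2ʲ·D_q·M_j)` with `D_q` a bound of the factor's jets of order `≤ j` AT `q` (at the flow frames: the Gevrey table rows of order `k ≤ j`, sup over `q`).

* `norm_iteratedFDeriv_symInterp_treeData_le_last` — tree data: `4·((2·(2ʲ·D_q·(2|β|L²S_j²)) + 2·(2·(2|β|L²S_j²·G))) + tail)`;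
* `norm_iteratedFDeriv_symInterp_dressingData_le_last` — dressing data: the `a`- and `b`-terms with `(2·(2ʲD_{qa}·¼) + …)`, `(2·(2ʲD_{qb}·¼S_j′) + …)`.

Proofs = p579409's verbatim with the layer-3′ lemma; no definitions; nothing asserts superconductivity.  References: BGM 2006 §2.3 (2.21)–(2.24)
[cite: BenfattoGiulianiMastropietro2006].
-/

noncomputable section

namespace Summit.HubbardSuperconductivity.HubbardSuperconductivity.Theorems.EngineV8

set_option linter.dupNamespace false -- summit = problem name (single-conjunct summit), D-0017

open Real Finset Filter Literature.MathematicalPhysics.QuantumLattice Literature.Probability.LatticeModels GrassmannAlgebra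
open Summit.HubbardSuperconductivity.HubbardSuperconductivity.Theorems.KLRegimeSplit
open Summit.HubbardSuperconductivity.HubbardSuperconductivity.Theorems.TwoVolumeDefect
open scoped ComplexConjugate

variable {L M : ℕ} [NeZero L]

/-! ## §2′ Tree jets at the last scale -/

/-- **LAST SCALE: THE TREE JETS `A, A′` OF THE CORRECTED (B) DOOR = LEIBNIZ TERM AT `q` + ALIASING** (no vanishing; jets `‖Dᵏg_i(q)‖ ≤ D_q`, `k ≤ j`).  Abstract symbols `s₀, s₁` whose difference on the two reading frequencies
is the sampled continuum factor `g_i` (smooth, `2π`-periodic, `D₄`-symmetric, vanishing near `q`, `‖D^{Md} g_i‖ ≤ D_g`, `‖g_i‖ ≤ A₀`, `4 + j ≤ Md`), and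
two-leg `(1+|x̃|)`-moments `S_j, S_s` of `𝒲_t = 𝒲′[s₀ + t(s₁−s₀)]` at the strings `((i,·),σ)`: for every `t ∈ [0,1]` both the real and the imaginary tree datum have
`‖Dʲ[evalM symInterp(·)](q)‖ ≤ 4·(2·(2·(2|β|L²S_j²·(3ʲD_g(2/N)^{Md−j−4}·4C₂))) + L²Lʲ·(A₀·(2|β|L²S_s²/(1+L/4)ˢ)))`. [cite: BenfattoGiulianiMastropietro2006, §2.3 (2.21)–(2.24)] -/
theorem norm_iteratedFDeriv_symInterp_treeData_le_last (s₀ s₁ : FreqMomentum L M × Fin 2 → ℂ) (β U : ℝ) (K : TrigPolyC4v) (i₁ i₂ : MatsubaraIdx M)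
    {g : MatsubaraIdx M → Momentum → ℂ}
    (hs : ∀ i ∈ ({i₁, i₂} : Finset (MatsubaraIdx M)), ∀ (kv : TorusSite 2 L) (σ : Fin 2),
      s₁ ((i, kv), σ) - s₀ ((i, kv), σ) = g i (WithLp.toLp 2 (latticeMomentum L kv)))
    (hgper : ∀ i ∈ ({i₁, i₂} : Finset (MatsubaraIdx M)), ∀ (c : Fin 2) (q : Momentum), g i (q + EuclideanSpace.single c (2 * π)) = g i q)
    (hg : ∀ i ∈ ({i₁, i₂} : Finset (MatsubaraIdx M)), ContDiff ℝ (⊤ : ℕ∞) (g i))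
    (hrefl : ∀ i ∈ ({i₁, i₂} : Finset (MatsubaraIdx M)), ∀ p : Fin 2 → ℝ, g i (WithLp.toLp 2 ![p 0, -p 1]) = g i (WithLp.toLp 2 p))
    (hswap : ∀ i ∈ ({i₁, i₂} : Finset (MatsubaraIdx M)), ∀ p : Fin 2 → ℝ, g i (WithLp.toLp 2 ![p 1, p 0]) = g i (WithLp.toLp 2 p))
    {j Md : ℕ} (hM : 4 + j ≤ Md) {Dg A₀ : ℝ} (hDg : ∀ i ∈ ({i₁, i₂} : Finset (MatsubaraIdx M)), ∀ q, ‖iteratedFDeriv ℝ Md (g i) q‖ ≤ Dg)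
    (hA₀ : ∀ i ∈ ({i₁, i₂} : Finset (MatsubaraIdx M)), ∀ q, ‖g i q‖ ≤ A₀)
    {q : Momentum} {Dq : ℝ} (hDq : ∀ i ∈ ({i₁, i₂} : Finset (MatsubaraIdx M)), ∀ k ≤ j, ‖iteratedFDeriv ℝ k (g i) q‖ ≤ Dq)
    {s : ℕ} {Sj Ss : ℝ}
    (hR : ∀ t ∈ Set.Icc (0 : ℝ) 1, ∀ i ∈ ({i₁, i₂} : Finset (MatsubaraIdx M)), ∀ σ : Fin 2,
      (∑ x : TorusSite 2 L, (1 + ((x 0).valMinAbs.natAbs : ℝ) + ((x 1).valMinAbs.natAbs : ℝ)) ^ j * ‖torusFourierInv (fun kv : TorusSite 2 L =>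
        kernel ℂ (effAction ℂ (normalCovariance L M s₀ + ((t : ℂ)) • (normalCovariance L M s₁ - normalCovariance L M s₀))
          (hubbardInteraction L M β U + counterQuadratic L M β K)) 2 ![((((i, kv), σ), 0) : HubbardFieldIdx L M), (((i, kv), σ), 1)]) x‖ ≤ Sj) ∧
      (∑ x : TorusSite 2 L, (1 + ((x 0).valMinAbs.natAbs : ℝ) + ((x 1).valMinAbs.natAbs : ℝ)) ^ s * ‖torusFourierInv (fun kv : TorusSite 2 L =>
        kernel ℂ (effAction ℂ (normalCovariance L M s₀ + ((t : ℂ)) • (normalCovariance L M s₁ - normalCovariance L M s₀))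
          (hubbardInteraction L M β U + counterQuadratic L M β K)) 2 ![((((i, kv), σ), 0) : HubbardFieldIdx L M), (((i, kv), σ), 1)]) x‖ ≤ Ss)) :
    ∀ t ∈ Set.Icc (0 : ℝ) 1,
      ‖iteratedFDeriv ℝ j (evalM (symInterp L (fun kv : TorusSite 2 L => ((∑ σ : Fin 2,
        (selfEnergy L M β (grassmannDerivPairing ℂ (normalCovariance L M s₁ - normalCovariance L M s₀)
            (effAction ℂ (normalCovariance L M s₀ + ((t : ℂ)) • (normalCovariance L M s₁ - normalCovariance L M s₀))
              (hubbardInteraction L M β U + counterQuadratic L M β K))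
            (effAction ℂ (normalCovariance L M s₀ + ((t : ℂ)) • (normalCovariance L M s₁ - normalCovariance L M s₀))
              (hubbardInteraction L M β U + counterQuadratic L M β K))) (i₁, kv) σ +
          selfEnergy L M β (grassmannDerivPairing ℂ (normalCovariance L M s₁ - normalCovariance L M s₀)
            (effAction ℂ (normalCovariance L M s₀ + ((t : ℂ)) • (normalCovariance L M s₁ - normalCovariance L M s₀))
              (hubbardInteraction L M β U + counterQuadratic L M β K))
            (effAction ℂ (normalCovariance L M s₀ + ((t : ℂ)) • (normalCovariance L M s₁ - normalCovariance L M s₀))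
              (hubbardInteraction L M β U + counterQuadratic L M β K))) (i₂, kv) σ)) / 4).re))) q‖ ≤
        4 * ((2 * (2 ^ j * Dq * (2 * |β| * (L : ℝ) ^ 2 * Sj ^ 2)) + 2 * (2 * ((2 * |β| * (L : ℝ) ^ 2 * Sj ^ 2) * ((3 : ℝ) ^ j * Dg * (2 / ((2 * (L / 4 + 1) : ℕ) : ℝ)) ^ (Md - j - 4) *
          (2 ^ 2 * ∑' k : Fin 2 → ℤ, ∏ c, (1 + (k c : ℝ) ^ 2)⁻¹))))) +
          (L : ℝ) ^ 2 * (L : ℝ) ^ j * (A₀ * ((2 * |β| * (L : ℝ) ^ 2 * Ss ^ 2) / (1 + (L : ℝ) / 4) ^ s))) ∧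
      ‖iteratedFDeriv ℝ j (evalM (symInterp L (fun kv : TorusSite 2 L => ((∑ σ : Fin 2,
        (selfEnergy L M β (grassmannDerivPairing ℂ (normalCovariance L M s₁ - normalCovariance L M s₀)
            (effAction ℂ (normalCovariance L M s₀ + ((t : ℂ)) • (normalCovariance L M s₁ - normalCovariance L M s₀))
              (hubbardInteraction L M β U + counterQuadratic L M β K))
            (effAction ℂ (normalCovariance L M s₀ + ((t : ℂ)) • (normalCovariance L M s₁ - normalCovariance L M s₀))
              (hubbardInteraction L M β U + counterQuadratic L M β K))) (i₁, kv) σ +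
          selfEnergy L M β (grassmannDerivPairing ℂ (normalCovariance L M s₁ - normalCovariance L M s₀)
            (effAction ℂ (normalCovariance L M s₀ + ((t : ℂ)) • (normalCovariance L M s₁ - normalCovariance L M s₀))
              (hubbardInteraction L M β U + counterQuadratic L M β K))
            (effAction ℂ (normalCovariance L M s₀ + ((t : ℂ)) • (normalCovariance L M s₁ - normalCovariance L M s₀))
              (hubbardInteraction L M β U + counterQuadratic L M β K))) (i₂, kv) σ)) / 4).im))) q‖ ≤
        4 * ((2 * (2 ^ j * Dq * (2 * |β| * (L : ℝ) ^ 2 * Sj ^ 2)) + 2 * (2 * ((2 * |β| * (L : ℝ) ^ 2 * Sj ^ 2) * ((3 : ℝ) ^ j * Dg * (2 / ((2 * (L / 4 + 1) : ℕ) : ℝ)) ^ (Md - j - 4) *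
          (2 ^ 2 * ∑' k : Fin 2 → ℤ, ∏ c, (1 + (k c : ℝ) ^ 2)⁻¹))))) +
          (L : ℝ) ^ 2 * (L : ℝ) ^ j * (A₀ * ((2 * |β| * (L : ℝ) ^ 2 * Ss ^ 2) / (1 + (L : ℝ) / 4) ^ s))) := by
  intro t ht
  have hi₁ : i₁ ∈ ({i₁, i₂} : Finset (MatsubaraIdx M)) := by simp
  have hi₂ : i₂ ∈ ({i₁, i₂} : Finset (MatsubaraIdx M)) := by simp
  -- abbreviations
  set W := effAction ℂ (normalCovariance L M s₀ + ((t : ℂ)) • (normalCovariance L M s₁ - normalCovariance L M s₀))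
    (hubbardInteraction L M β U + counterQuadratic L M β K) with hW
  set C : ℂ := ((((Nat.factorial 2 : ℕ) : ℝ) * (β * (L : ℝ) ^ 2) ^ (2 - 1) : ℝ) : ℂ) with hC
  set R : MatsubaraIdx M → Fin 2 → TorusSite 2 L → ℂ := fun i σ kv =>
    kernel ℂ W 2 ![((((i, kv), σ), 0) : HubbardFieldIdx L M), (((i, kv), σ), 1)] with hR'
  set Gb : ℝ := (3 : ℝ) ^ j * Dg * (2 / ((2 * (L / 4 + 1) : ℕ) : ℝ)) ^ (Md - j - 4) * (2 ^ 2 * ∑' k : Fin 2 → ℤ, ∏ c, (1 + (k c : ℝ) ^ 2)⁻¹) with hGb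
  have hCnorm : ‖C‖ = 2 * |β| * (L : ℝ) ^ 2 := by
    rw [hC, Complex.norm_real, Real.norm_eq_abs]
    simp [Nat.factorial, abs_mul, mul_assoc]
  -- the tree term as a product, at both frequencies
  have hSE : ∀ i ∈ ({i₁, i₂} : Finset (MatsubaraIdx M)), ∀ (kv : TorusSite 2 L) (σ : Fin 2),
      selfEnergy L M β (grassmannDerivPairing ℂ (normalCovariance L M s₁ - normalCovariance L M s₀) W W) (i, kv) σ =
        g i (WithLp.toLp 2 (latticeMomentum L kv)) * (C * (4 * R i σ kv ^ 2)) := by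
    intro i hi kv σ
    rw [hW, selfEnergy_derivPairing_eq s₀ s₁ β U K t i kv σ, hs i hi kv σ]
    ring
  -- one dressed term
  have hterm : ∀ i ∈ ({i₁, i₂} : Finset (MatsubaraIdx M)), ∀ σ : Fin 2, ∀ c : ℂ, ‖c‖ = 1 →
      ‖iteratedFDeriv ℝ j (evalM (symInterp L (fun kv : TorusSite 2 L =>
        (g i (WithLp.toLp 2 (latticeMomentum L kv)) * ((c * C) * R i σ kv ^ 2)).re))) q‖ ≤
        (2 * (2 ^ j * Dq * (2 * |β| * (L : ℝ) ^ 2 * Sj ^ 2)) + 2 * (2 * ((2 * |β| * (L : ℝ) ^ 2 * Sj ^ 2) * Gb))) + (L : ℝ) ^ 2 * (L : ℝ) ^ j * (A₀ * ((2 * |β| * (L : ℝ) ^ 2 * Ss ^ 2) / (1 + (L : ℝ) / 4) ^ s)) := by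
    intro i hi σ c hc
    have hcC : ‖c * C‖ = 2 * |β| * (L : ℝ) ^ 2 := by rw [norm_mul, hc, one_mul, hCnorm]
    have hMj := momentSum_const_mul_sq_le (c * C) (R i σ) j (hR t ht i hi σ).1
    have hMs := momentSum_const_mul_sq_le (c * C) (R i σ) s (hR t ht i hi σ).2
    rw [hcC] at hMj hMs
    exact norm_iteratedFDeriv_evalM_symInterp_dressed_le_of_jets (hgper i hi) (hg i hi) (hrefl i hi) (hswap i hi) (fun kv => (c * C) * R i σ kv ^ 2)
      hM (hDg i hi) (hA₀ i hi) hMj hMs (hDq i hi)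
  -- the two data functions as sums of dressed terms
  have hre : (fun kv : TorusSite 2 L => ((∑ σ : Fin 2,
      (selfEnergy L M β (grassmannDerivPairing ℂ (normalCovariance L M s₁ - normalCovariance L M s₀) W W) (i₁, kv) σ +
        selfEnergy L M β (grassmannDerivPairing ℂ (normalCovariance L M s₁ - normalCovariance L M s₀) W W) (i₂, kv) σ)) / 4).re) =
      fun kv => ∑ σ : Fin 2, ((g i₁ (WithLp.toLp 2 (latticeMomentum L kv)) * ((1 * C) * R i₁ σ kv ^ 2)).re +
        (g i₂ (WithLp.toLp 2 (latticeMomentum L kv)) * ((1 * C) * R i₂ σ kv ^ 2)).re) := by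
    funext kv
    rw [sum_div, Complex.re_sum]
    refine sum_congr rfl fun σ _ => ?_
    rw [hSE i₁ hi₁ kv σ, hSE i₂ hi₂ kv σ, ← Complex.add_re]
    congr 1
    ring
  have him : (fun kv : TorusSite 2 L => ((∑ σ : Fin 2,
      (selfEnergy L M β (grassmannDerivPairing ℂ (normalCovariance L M s₁ - normalCovariance L M s₀) W W) (i₁, kv) σ +
        selfEnergy L M β (grassmannDerivPairing ℂ (normalCovariance L M s₁ - normalCovariance L M s₀) W W) (i₂, kv) σ)) / 4).im) =
      fun kv => ∑ σ : Fin 2, ((g i₁ (WithLp.toLp 2 (latticeMomentum L kv)) * ((-Complex.I * C) * R i₁ σ kv ^ 2)).re +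
        (g i₂ (WithLp.toLp 2 (latticeMomentum L kv)) * ((-Complex.I * C) * R i₂ σ kv ^ 2)).re) := by
    funext kv
    rw [im_eq_re_negI_mul, ← mul_div_assoc, mul_sum, sum_div, Complex.re_sum]
    refine sum_congr rfl fun σ _ => ?_
    rw [hSE i₁ hi₁ kv σ, hSE i₂ hi₂ kv σ, ← Complex.add_re]
    congr 1
    ring
  -- splitting the jets over the finite sums
  have hsplit : ∀ c : ℂ, ‖c‖ = 1 →
      ‖iteratedFDeriv ℝ j (evalM (symInterp L (fun kv => ∑ σ : Fin 2,
        ((g i₁ (WithLp.toLp 2 (latticeMomentum L kv)) * ((c * C) * R i₁ σ kv ^ 2)).re +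
          (g i₂ (WithLp.toLp 2 (latticeMomentum L kv)) * ((c * C) * R i₂ σ kv ^ 2)).re)))) q‖ ≤
        4 * ((2 * (2 ^ j * Dq * (2 * |β| * (L : ℝ) ^ 2 * Sj ^ 2)) + 2 * (2 * ((2 * |β| * (L : ℝ) ^ 2 * Sj ^ 2) * Gb))) + (L : ℝ) ^ 2 * (L : ℝ) ^ j * (A₀ * ((2 * |β| * (L : ℝ) ^ 2 * Ss ^ 2) / (1 + (L : ℝ) / 4) ^ s))) := by
    intro c hc
    have hfun : evalM (symInterp L (fun kv => ∑ σ : Fin 2,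
        ((g i₁ (WithLp.toLp 2 (latticeMomentum L kv)) * ((c * C) * R i₁ σ kv ^ 2)).re +
          (g i₂ (WithLp.toLp 2 (latticeMomentum L kv)) * ((c * C) * R i₂ σ kv ^ 2)).re))) =
        fun q' => ∑ σ : Fin 2, (evalM (symInterp L (fun kv => (g i₁ (WithLp.toLp 2 (latticeMomentum L kv)) * ((c * C) * R i₁ σ kv ^ 2)).re)) q' +
          evalM (symInterp L (fun kv => (g i₂ (WithLp.toLp 2 (latticeMomentum L kv)) * ((c * C) * R i₂ σ kv ^ 2)).re)) q') := by
      funext q'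
      rw [evalM_apply, eval_symInterp_finset_sum L univ]
      refine sum_congr rfl fun σ _ => ?_
      rw [eval_symInterp_add L]
      rfl
    have hcd : ∀ f : TorusSite 2 L → ℝ, ContDiff ℝ j (evalM (symInterp L f)) := fun f => contDiff_evalM _
    rw [hfun, iteratedFDeriv_fun_sum_apply fun σ _ => ((hcd _).add (hcd _)).contDiffAt]
    refine (norm_sum_le _ _).trans ?_
    calc ∑ σ : Fin 2, ‖iteratedFDeriv ℝ j (fun q' =>
            evalM (symInterp L (fun kv => (g i₁ (WithLp.toLp 2 (latticeMomentum L kv)) * ((c * C) * R i₁ σ kv ^ 2)).re)) q' +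
            evalM (symInterp L (fun kv => (g i₂ (WithLp.toLp 2 (latticeMomentum L kv)) * ((c * C) * R i₂ σ kv ^ 2)).re)) q') q‖
        ≤ ∑ _σ : Fin 2, (((2 * (2 ^ j * Dq * (2 * |β| * (L : ℝ) ^ 2 * Sj ^ 2)) + 2 * (2 * ((2 * |β| * (L : ℝ) ^ 2 * Sj ^ 2) * Gb))) +
            (L : ℝ) ^ 2 * (L : ℝ) ^ j * (A₀ * ((2 * |β| * (L : ℝ) ^ 2 * Ss ^ 2) / (1 + (L : ℝ) / 4) ^ s))) +
            ((2 * (2 ^ j * Dq * (2 * |β| * (L : ℝ) ^ 2 * Sj ^ 2)) + 2 * (2 * ((2 * |β| * (L : ℝ) ^ 2 * Sj ^ 2) * Gb))) +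
            (L : ℝ) ^ 2 * (L : ℝ) ^ j * (A₀ * ((2 * |β| * (L : ℝ) ^ 2 * Ss ^ 2) / (1 + (L : ℝ) / 4) ^ s)))) := by
          refine sum_le_sum fun σ _ => ?_
          rw [fun_iteratedFDeriv_add_apply (hcd _).contDiffAt (hcd _).contDiffAt]
          exact (norm_add_le _ _).trans (add_le_add (hterm i₁ hi₁ σ c hc) (hterm i₂ hi₂ σ c hc))
      _ = 4 * ((2 * (2 ^ j * Dq * (2 * |β| * (L : ℝ) ^ 2 * Sj ^ 2)) + 2 * (2 * ((2 * |β| * (L : ℝ) ^ 2 * Sj ^ 2) * Gb))) +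
            (L : ℝ) ^ 2 * (L : ℝ) ^ j * (A₀ * ((2 * |β| * (L : ℝ) ^ 2 * Ss ^ 2) / (1 + (L : ℝ) / 4) ^ s))) := by
          rw [sum_const, Finset.card_univ, Fintype.card_fin, nsmul_eq_mul]
          push_cast
          ring
  refine ⟨?_, ?_⟩
  · rw [hre]; exact hsplit 1 norm_one
  · rw [him]; exact hsplit (-Complex.I) (by simp)

/-! ## §3′ Dressing jets at the last scale -/

/-- **LAST SCALE: THE DRESSING JETS `A_J` = LEIBNIZ TERMS AT `q` + ALIASING** (no vanishing; jets `‖Dᵏa_i(q)‖ ≤ D_{qa}`, `‖Dᵏb_i(q)‖ ≤ D_{qb}`, `k ≤ j`).  Lattice dressing data `A_i(k,σ) = a_i(p_k)`, `B_i(k,σ) = b_i(p_k)` on a finite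
set `I` of frequencies, with continuum factors `a_i, b_i` smooth, `2π`-periodic, `D₄`-symmetric, vanishing near `q` (`‖D^{Md}·‖ ≤ D_a, D_b`, `‖·‖ ≤ A_a, A_b`,
`4 + j ≤ Md`), and an arbitrary lattice factor `Σ′` with `(1+|x̃|)`-moments `S_j′, S_s′` at the strings:
`‖Dʲ[evalM symInterp(k ↦ ¼·Re Σ_σΣ_{i∈I}(A_i(k,σ) + B_i(k,σ)·Σ′((i,k),σ)))](q)‖ ≤ 2|I|·([a-term, H = ¼] + [b-term, H = ¼Σ′])`.
[cite: BenfattoGiulianiMastropietro2006, §2.3 (2.23)] -/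
theorem norm_iteratedFDeriv_symInterp_dressingData_le_last (I : Finset (MatsubaraIdx M)) (A B : MatsubaraIdx M → TorusSite 2 L → Fin 2 → ℂ)
    (SE : FreqMomentum L M → Fin 2 → ℂ) {a b : MatsubaraIdx M → Momentum → ℂ}
    (hA : ∀ i ∈ I, ∀ (kv : TorusSite 2 L) (σ : Fin 2), A i kv σ = a i (WithLp.toLp 2 (latticeMomentum L kv)))
    (hB : ∀ i ∈ I, ∀ (kv : TorusSite 2 L) (σ : Fin 2), B i kv σ = b i (WithLp.toLp 2 (latticeMomentum L kv)))
    (haper : ∀ i ∈ I, ∀ (c : Fin 2) (q : Momentum), a i (q + EuclideanSpace.single c (2 * π)) = a i q)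
    (hbper : ∀ i ∈ I, ∀ (c : Fin 2) (q : Momentum), b i (q + EuclideanSpace.single c (2 * π)) = b i q)
    (ha : ∀ i ∈ I, ContDiff ℝ (⊤ : ℕ∞) (a i)) (hb : ∀ i ∈ I, ContDiff ℝ (⊤ : ℕ∞) (b i))
    (harefl : ∀ i ∈ I, ∀ p : Fin 2 → ℝ, a i (WithLp.toLp 2 ![p 0, -p 1]) = a i (WithLp.toLp 2 p))
    (haswap : ∀ i ∈ I, ∀ p : Fin 2 → ℝ, a i (WithLp.toLp 2 ![p 1, p 0]) = a i (WithLp.toLp 2 p))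
    (hbrefl : ∀ i ∈ I, ∀ p : Fin 2 → ℝ, b i (WithLp.toLp 2 ![p 0, -p 1]) = b i (WithLp.toLp 2 p))
    (hbswap : ∀ i ∈ I, ∀ p : Fin 2 → ℝ, b i (WithLp.toLp 2 ![p 1, p 0]) = b i (WithLp.toLp 2 p))
    {j Md : ℕ} (hM : 4 + j ≤ Md) {Da Db Aa Ab : ℝ}
    (hDa : ∀ i ∈ I, ∀ q, ‖iteratedFDeriv ℝ Md (a i) q‖ ≤ Da) (hDb : ∀ i ∈ I, ∀ q, ‖iteratedFDeriv ℝ Md (b i) q‖ ≤ Db)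
    (hAa : ∀ i ∈ I, ∀ q, ‖a i q‖ ≤ Aa) (hAb : ∀ i ∈ I, ∀ q, ‖b i q‖ ≤ Ab)
    {q : Momentum} {Dqa Dqb : ℝ} (hDqa : ∀ i ∈ I, ∀ k ≤ j, ‖iteratedFDeriv ℝ k (a i) q‖ ≤ Dqa) (hDqb : ∀ i ∈ I, ∀ k ≤ j, ‖iteratedFDeriv ℝ k (b i) q‖ ≤ Dqb)
    {s : ℕ} {Sj Ss : ℝ}
    (hS : ∀ i ∈ I, ∀ σ : Fin 2,
      (∑ x : TorusSite 2 L, (1 + ((x 0).valMinAbs.natAbs : ℝ) + ((x 1).valMinAbs.natAbs : ℝ)) ^ j *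
          ‖torusFourierInv (fun kv : TorusSite 2 L => SE (i, kv) σ) x‖ ≤ Sj) ∧
      (∑ x : TorusSite 2 L, (1 + ((x 0).valMinAbs.natAbs : ℝ) + ((x 1).valMinAbs.natAbs : ℝ)) ^ s *
          ‖torusFourierInv (fun kv : TorusSite 2 L => SE (i, kv) σ) x‖ ≤ Ss)) :
    ‖iteratedFDeriv ℝ j (evalM (symInterp L (fun kv : TorusSite 2 L =>
        (∑ σ : Fin 2, ∑ i ∈ I, (A i kv σ + B i kv σ * SE (i, kv) σ)).re / 4))) q‖ ≤
      2 * I.card * (((2 * (2 ^ j * Dqa * (1 / 4 : ℝ)) + 2 * (2 * ((1 / 4 : ℝ) * ((3 : ℝ) ^ j * Da * (2 / ((2 * (L / 4 + 1) : ℕ) : ℝ)) ^ (Md - j - 4) *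
          (2 ^ 2 * ∑' k : Fin 2 → ℤ, ∏ c, (1 + (k c : ℝ) ^ 2)⁻¹))))) + (L : ℝ) ^ 2 * (L : ℝ) ^ j * (Aa * ((1 / 4 : ℝ) / (1 + (L : ℝ) / 4) ^ s))) +
        ((2 * (2 ^ j * Dqb * (1 / 4 * Sj)) + 2 * (2 * ((1 / 4 * Sj) * ((3 : ℝ) ^ j * Db * (2 / ((2 * (L / 4 + 1) : ℕ) : ℝ)) ^ (Md - j - 4) *
          (2 ^ 2 * ∑' k : Fin 2 → ℤ, ∏ c, (1 + (k c : ℝ) ^ 2)⁻¹))))) + (L : ℝ) ^ 2 * (L : ℝ) ^ j * (Ab * ((1 / 4 * Ss) / (1 + (L : ℝ) / 4) ^ s)))) := by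
  classical
  set c₄ : ℂ := (((1 / 4 : ℝ)) : ℂ) with hc₄
  have hc₄n : ‖c₄‖ = 1 / 4 := by rw [hc₄, Complex.norm_real, Real.norm_eq_abs, abs_of_pos (by norm_num)]
  -- the data as a double sum of dressed terms
  have hdata : (fun kv : TorusSite 2 L => (∑ σ : Fin 2, ∑ i ∈ I, (A i kv σ + B i kv σ * SE (i, kv) σ)).re / 4) =
      fun kv => ∑ σ : Fin 2, ∑ i ∈ I, ((a i (WithLp.toLp 2 (latticeMomentum L kv)) * c₄).re +
        (b i (WithLp.toLp 2 (latticeMomentum L kv)) * (c₄ * SE (i, kv) σ)).re) := by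
    funext kv
    have hdiv : ∀ z : ℂ, z.re / 4 = (c₄ * z).re := fun z => by rw [hc₄, Complex.re_ofReal_mul]; ring
    rw [hdiv, mul_sum, Complex.re_sum]
    refine sum_congr rfl fun σ _ => ?_
    rw [mul_sum, Complex.re_sum]
    refine sum_congr rfl fun i hi => ?_
    rw [hA i hi kv σ, hB i hi kv σ, ← Complex.add_re]
    congr 1
    ring
  have hfun : evalM (symInterp L (fun kv => ∑ σ : Fin 2, ∑ i ∈ I, ((a i (WithLp.toLp 2 (latticeMomentum L kv)) * c₄).re +
        (b i (WithLp.toLp 2 (latticeMomentum L kv)) * (c₄ * SE (i, kv) σ)).re))) =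
      fun q' => ∑ σ : Fin 2, ∑ i ∈ I, (evalM (symInterp L (fun kv => (a i (WithLp.toLp 2 (latticeMomentum L kv)) * c₄).re)) q' +
        evalM (symInterp L (fun kv => (b i (WithLp.toLp 2 (latticeMomentum L kv)) * (c₄ * SE (i, kv) σ)).re)) q') := by
    funext q'
    rw [evalM_apply, eval_symInterp_finset_sum L univ]
    refine sum_congr rfl fun σ _ => ?_
    rw [eval_symInterp_finset_sum L I]
    refine sum_congr rfl fun i _ => ?_
    rw [eval_symInterp_add L]
    rfl
  have hcd : ∀ f : TorusSite 2 L → ℝ, ContDiff ℝ j (evalM (symInterp L f)) := fun f => contDiff_evalM _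
  -- the two dressed bounds
  have ha_term : ∀ i ∈ I, ‖iteratedFDeriv ℝ j (evalM (symInterp L (fun kv => (a i (WithLp.toLp 2 (latticeMomentum L kv)) * c₄).re))) q‖ ≤
      (2 * (2 ^ j * Dqa * (1 / 4 : ℝ)) + 2 * (2 * ((1 / 4 : ℝ) * ((3 : ℝ) ^ j * Da * (2 / ((2 * (L / 4 + 1) : ℕ) : ℝ)) ^ (Md - j - 4) *
          (2 ^ 2 * ∑' k : Fin 2 → ℤ, ∏ c, (1 + (k c : ℝ) ^ 2)⁻¹))))) + (L : ℝ) ^ 2 * (L : ℝ) ^ j * (Aa * ((1 / 4 : ℝ) / (1 + (L : ℝ) / 4) ^ s)) := by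
    intro i hi
    have hMj := momentSum_torusFourierInv_const (L := L) c₄ j
    have hMs := momentSum_torusFourierInv_const (L := L) c₄ s
    rw [hc₄n] at hMj hMs
    exact norm_iteratedFDeriv_evalM_symInterp_dressed_le_of_jets (haper i hi) (ha i hi) (harefl i hi) (haswap i hi) (fun _ => c₄)
      hM (hDa i hi) (hAa i hi) hMj.le hMs.le (hDqa i hi)
  have hb_term : ∀ i ∈ I, ∀ σ : Fin 2,
      ‖iteratedFDeriv ℝ j (evalM (symInterp L (fun kv => (b i (WithLp.toLp 2 (latticeMomentum L kv)) * (c₄ * SE (i, kv) σ)).re))) q‖ ≤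
      (2 * (2 ^ j * Dqb * (1 / 4 * Sj)) + 2 * (2 * ((1 / 4 * Sj) * ((3 : ℝ) ^ j * Db * (2 / ((2 * (L / 4 + 1) : ℕ) : ℝ)) ^ (Md - j - 4) *
          (2 ^ 2 * ∑' k : Fin 2 → ℤ, ∏ c, (1 + (k c : ℝ) ^ 2)⁻¹))))) + (L : ℝ) ^ 2 * (L : ℝ) ^ j * (Ab * ((1 / 4 * Ss) / (1 + (L : ℝ) / 4) ^ s)) := by
    intro i hi σ
    have hMj := momentSum_const_mul_le c₄ (fun kv => SE (i, kv) σ) j (hS i hi σ).1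
    have hMs := momentSum_const_mul_le c₄ (fun kv => SE (i, kv) σ) s (hS i hi σ).2
    rw [hc₄n] at hMj hMs
    exact norm_iteratedFDeriv_evalM_symInterp_dressed_le_of_jets (hbper i hi) (hb i hi) (hbrefl i hi) (hbswap i hi) (fun kv => c₄ * SE (i, kv) σ)
      hM (hDb i hi) (hAb i hi) hMj hMs (hDqb i hi)
  rw [hdata, hfun, iteratedFDeriv_fun_sum_apply fun σ _ => (ContDiff.sum fun i _ => (hcd _).add (hcd _)).contDiffAt]
  refine (norm_sum_le _ _).trans ?_
  have hinner : ∀ σ : Fin 2, ‖iteratedFDeriv ℝ j (fun q' => ∑ i ∈ I,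
      (evalM (symInterp L (fun kv => (a i (WithLp.toLp 2 (latticeMomentum L kv)) * c₄).re)) q' +
        evalM (symInterp L (fun kv => (b i (WithLp.toLp 2 (latticeMomentum L kv)) * (c₄ * SE (i, kv) σ)).re)) q')) q‖ ≤
      I.card * (((2 * (2 ^ j * Dqa * (1 / 4 : ℝ)) + 2 * (2 * ((1 / 4 : ℝ) * ((3 : ℝ) ^ j * Da * (2 / ((2 * (L / 4 + 1) : ℕ) : ℝ)) ^ (Md - j - 4) *
          (2 ^ 2 * ∑' k : Fin 2 → ℤ, ∏ c, (1 + (k c : ℝ) ^ 2)⁻¹))))) + (L : ℝ) ^ 2 * (L : ℝ) ^ j * (Aa * ((1 / 4 : ℝ) / (1 + (L : ℝ) / 4) ^ s))) +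
        ((2 * (2 ^ j * Dqb * (1 / 4 * Sj)) + 2 * (2 * ((1 / 4 * Sj) * ((3 : ℝ) ^ j * Db * (2 / ((2 * (L / 4 + 1) : ℕ) : ℝ)) ^ (Md - j - 4) *
          (2 ^ 2 * ∑' k : Fin 2 → ℤ, ∏ c, (1 + (k c : ℝ) ^ 2)⁻¹))))) + (L : ℝ) ^ 2 * (L : ℝ) ^ j * (Ab * ((1 / 4 * Ss) / (1 + (L : ℝ) / 4) ^ s)))) := by
    intro σ
    rw [iteratedFDeriv_fun_sum_apply fun i _ => ((hcd _).add (hcd _)).contDiffAt]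
    refine (norm_sum_le _ _).trans ?_
    refine (sum_le_sum fun i hi => ?_).trans (le_of_eq (by rw [sum_const, nsmul_eq_mul]))
    rw [fun_iteratedFDeriv_add_apply (hcd _).contDiffAt (hcd _).contDiffAt]
    exact (norm_add_le _ _).trans (add_le_add (ha_term i hi) (hb_term i hi σ))
  refine (sum_le_sum fun σ _ => hinner σ).trans (le_of_eq ?_)
  rw [sum_const, Finset.card_univ, Fintype.card_fin, nsmul_eq_mul]
  push_cast
  ring

end Summit.HubbardSuperconductivity.HubbardSuperconductivity.Theorems.EngineV8

end
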